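import Summits.Ventures.CertifiedManyBodySolver.Downfold.EmeryScaleRayLeaf
import Summits.Ventures.CertifiedManyBodySolver.Downfold.EmeryScaleLeverCheck
import HarnessLib

/-!
# THE RAY CELL AND THE VALUE CELL OF THE SCALE COORDINATE: `T(A + s·(0,0,b,c)) ≤ (1 + s)·T(A)` (UPPER) / `(1 − s)·T(A) ≤ T(A − s·(0,0,b,c))` (LOWER) at
# FIXED FILLING over an anchor family, and `T̃ ≤ U` / `T̃ ≥ L` over an edge cell — the two cells of the TELESCOPED-EDGE / SCALING-RAY device (INFL-3to1-B §B.91)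

Venture CertifiedManyBodySolver, cell `pub/hubbard-downfold` (stage S1; INFLATION-RULES-3to1-B §B.91), seat hubbard-downfold-mod-4 (technique B = band
level, g40); namespace `Summit.Ventures.CertifiedManyBodySolver.Downfold.Emery`. Everything PROVED (0 sorry). WHAT THIS IS NOT: a statement about any
material; no number lives here; `U = 0` one-body kinematics of the σ model.

OBJECT. `T(θ) = t_node(θ; ε_F(θ; ν))`, `t = scaleNodeN/scaleNodeD`. By the scaling law (`EmeryScalingLaw`) a member `θ = (Δ, a, b, c)` of a typed box with
`a ≤ a₂` is `μ⁻¹·(μΔ, a₂, μb, μc)` with `μ = a₂/a ≥ 1` and `T(θ) = T(μθ)/μ`; the scaled point is reached from `(μΔ, a₂, b, c)` along the oxygen-hopping RAY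
`s ↦ (μΔ, a₂, b + s·b, c + s·c)`, `s = μ − 1`. The RAY CELL certifies, for every anchor `A` of a family box and every `s` of a step cell, the sub-homogeneity
`T(A + s·d) ≤ (1 + s)·T(A)` (UPPER; LOWER: `(1 − s)·T(A) ≤ T(A + s·d)` with `d = −(0,0,b,c)`) from (i) a contour-nesting bound on the member's Fermi energy
(`EmeryContourNesting.fermiEnergyOf_le_of_transfer` through the kernel leaves `nestLeaf` of `EmeryScaleLeverFI`, here with a `t_pp′` component of the
move), (ii) the energy antitonicity of `t` (`scaleNode_div_antitone`), (iii) the kernel RAY LEAF of `EmeryScaleRayLeaf`. The VALUE CELL bounds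
`t((Δ, a, b, cP); e)` by a scaled integer over a family box through the VALUE LEAF under bisection.

* §1 `RayCellData`, the three leaves `rayEasyLeaf` / `rayHardLeaf` / `rayPathLeaf` on `SBox`es (direction with a `t_pp′` component, base `t_pp′` interval
  carried in the data) and their pointwise meanings.
* §2 **`rayCellCheck`** and its readings **`ray_upper_cell`** / **`ray_lower_cell`**.
* §3 **`valueCheck`** (bisection of the value leaf) and **`scaleNode_div_le_of_valueCheck`** / **`le_scaleNode_div_of_valueCheck`**.

Sources: three-band model [HybertsenSchluterChristensen1989, Eq. (1)]; energy-linearised one-band image [AndersenEtAl1995, §6]; interval arithmetic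
[folklore] (Moore 1966).
-/

noncomputable section

namespace Summit.Ventures.CertifiedManyBodySolver.Downfold.Emery

open Real Set Literature.Analysis.ValidatedNumerics.Numerics

/-! ## §1 Ray cell data and leaves -/

/-- Move data of a ray cell: direction `(dΔ, da, db, dc)` (FIs; `db`, `dc` may be fat copies of the anchor family), the base `t_pp′` interval `IC`, and
the three energy rates `σe` (easy nesting), `σh` (hard nesting), `σp` (ray leaf). [folklore] -/
structure RayCellData where
  /-- direction, Δ component -/
  dD : FI
  /-- direction, `t_pd` component -/
  dA : FI
  /-- direction, `t_pp` component -/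
  dB : FI
  /-- direction, `t_pp′` component -/
  dC : FI
  /-- `t_pp′` of the anchor rows -/
  IC : FI
  /-- energy rate of the easy nesting pair -/
  sgE : FI
  /-- energy rate of the hard nesting pair -/
  sgH : FI
  /-- energy rate of the ray pair -/
  sgP : FI

/-- Easy leaf: base = anchor `(Δ, a, b, c)` at `e`, move `+d`, rate `σe`. [folklore] -/
def rayEasyLeaf (cd : RayCellData) (B : SBox) : Bool :=
  nestLeaf B.iD B.iA B.iB cd.IC B.iE cd.dD cd.dA cd.dB cd.dC cd.sgE B.iS

/-- Hard leaf: base = member `(Δ + s dΔ, a + s da, b + s db, c + s dc)` at `e`, move `−d`, rate `σh`. [folklore] -/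
def rayHardLeaf (cd : RayCellData) (B : SBox) : Bool :=
  nestLeaf (B.iD.add (B.iS.mul cd.dD)) (B.iA.add (B.iS.mul cd.dA)) (B.iB.add (B.iS.mul cd.dB)) (cd.IC.add (B.iS.mul cd.dC)) B.iE cd.dD.neg cd.dA.neg
    cd.dB.neg cd.dC.neg cd.sgH B.iS

/-- Ray leaf: base = anchor at `e`, move `+d`, rate `σp`; `upper` selects `Ψ ≤ 1` / `−1 ≤ Ψ`. [folklore] -/
def rayPathLeaf (upper : Bool) (cd : RayCellData) (B : SBox) : Bool :=
  rayLeaf upper B.iD B.iA B.iB cd.IC B.iE cd.dD cd.dA cd.dB cd.dC cd.sgP B.iS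

section Leaves

variable {cd : RayCellData} {dΔ da db dc c σe σh σp : ℝ}

/-- Meaning of `rayEasyLeaf`. [folklore] -/
theorem rayEasyLeaf_sound (hcd : (FI.mem dΔ cd.dD ∧ FI.mem da cd.dA ∧ FI.mem db cd.dB ∧ FI.mem dc cd.dC ∧ FI.mem c cd.IC ∧ FI.mem σe cd.sgE ∧ FI.mem σh cd.sgH ∧ FI.mem σp cd.sgP)) (B : SBox) (h : rayEasyLeaf cd B = true) (Δ a b s e : ℝ)
    (hm : (FI.mem Δ B.iD ∧ FI.mem a B.iA ∧ FI.mem b B.iB ∧ FI.mem s B.iS ∧ FI.mem e B.iE)) :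
    ∀ x y : ℝ, x ∈ Icc (0 : ℝ) 1 → y ∈ Icc (0 : ℝ) 1 → 0 ≤ charCubic Δ a b c x y e →
      0 ≤ charCubic (Δ + s * dΔ) (a + s * da) (b + s * db) (c + s * dc) x y (e + s * σe) := by
  intro x y hx hy hf
  obtain ⟨h1, h2, h3, h4, h5⟩ := hm
  obtain ⟨g1, g2, g3, g4, g5, g6, -, -⟩ := hcd
  exact charCubic_transfer_of_nestLeaf h h1 h2 h3 g5 h5 g1 g2 g3 g4 g6 h4 hx hy hf

/-- Meaning of `rayHardLeaf`. [folklore] -/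
theorem rayHardLeaf_sound (hcd : (FI.mem dΔ cd.dD ∧ FI.mem da cd.dA ∧ FI.mem db cd.dB ∧ FI.mem dc cd.dC ∧ FI.mem c cd.IC ∧ FI.mem σe cd.sgE ∧ FI.mem σh cd.sgH ∧ FI.mem σp cd.sgP)) (B : SBox) (h : rayHardLeaf cd B = true) (Δ a b s e : ℝ)
    (hm : (FI.mem Δ B.iD ∧ FI.mem a B.iA ∧ FI.mem b B.iB ∧ FI.mem s B.iS ∧ FI.mem e B.iE)) :
    ∀ x y : ℝ, x ∈ Icc (0 : ℝ) 1 → y ∈ Icc (0 : ℝ) 1 → 0 ≤ charCubic (Δ + s * dΔ) (a + s * da) (b + s * db) (c + s * dc) x y e →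
      0 ≤ charCubic Δ a b c x y (e + s * σh) := by
  intro x y hx hy hf
  obtain ⟨h1, h2, h3, h4, h5⟩ := hm
  obtain ⟨g1, g2, g3, g4, g5, -, g7, -⟩ := hcd
  have m1 := FI.mem_add h1 (FI.mem_mul h4 g1)
  have m2 := FI.mem_add h2 (FI.mem_mul h4 g2)
  have m3 := FI.mem_add h3 (FI.mem_mul h4 g3)
  have m4 := FI.mem_add g5 (FI.mem_mul h4 g4)
  have := charCubic_transfer_of_nestLeaf h m1 m2 m3 m4 h5 (FI.mem_neg g1) (FI.mem_neg g2) (FI.mem_neg g3) (FI.mem_neg g4) g7 h4 hx hy hf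
  simp only [mul_neg] at this
  have e1 : Δ + s * dΔ + -(s * dΔ) = Δ := by ring
  have e2 : a + s * da + -(s * da) = a := by ring
  have e3 : b + s * db + -(s * db) = b := by ring
  have e4 : c + s * dc + -(s * dc) = c := by ring
  rw [e1, e2, e3, e4] at this
  exact this

/-- Meaning of `rayPathLeaf true`. [folklore] -/
theorem rayPathLeaf_upper_sound (hcd : (FI.mem dΔ cd.dD ∧ FI.mem da cd.dA ∧ FI.mem db cd.dB ∧ FI.mem dc cd.dC ∧ FI.mem c cd.IC ∧ FI.mem σe cd.sgE ∧ FI.mem σh cd.sgH ∧ FI.mem σp cd.sgP)) (B : SBox) (h : rayPathLeaf true cd B = true) (Δ a b s e : ℝ)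
    (hm : (FI.mem Δ B.iD ∧ FI.mem a B.iA ∧ FI.mem b B.iB ∧ FI.mem s B.iS ∧ FI.mem e B.iE)) :
    scaleNodeN (Δ + s * dΔ) (a + s * da) (b + s * db) (c + s * dc) (e + s * σp) / scaleNodeD (Δ + s * dΔ) (a + s * da) (b + s * db) (c + s * dc) (e + s * σp) ≤
      (1 + s) * (scaleNodeN Δ a b c e / scaleNodeD Δ a b c e) := by
  obtain ⟨h1, h2, h3, h4, h5⟩ := hm
  obtain ⟨g1, g2, g3, g4, g5, -, -, g8⟩ := hcd
  exact scaleNode_le_mul_of_rayLeaf h h1 h2 h3 g5 h5 g1 g2 g3 g4 g8 h4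

/-- Meaning of `rayPathLeaf false`. [folklore] -/
theorem rayPathLeaf_lower_sound (hcd : (FI.mem dΔ cd.dD ∧ FI.mem da cd.dA ∧ FI.mem db cd.dB ∧ FI.mem dc cd.dC ∧ FI.mem c cd.IC ∧ FI.mem σe cd.sgE ∧ FI.mem σh cd.sgH ∧ FI.mem σp cd.sgP)) (B : SBox) (h : rayPathLeaf false cd B = true) (Δ a b s e : ℝ)
    (hm : (FI.mem Δ B.iD ∧ FI.mem a B.iA ∧ FI.mem b B.iB ∧ FI.mem s B.iS ∧ FI.mem e B.iE)) :
    (1 - s) * (scaleNodeN Δ a b c e / scaleNodeD Δ a b c e) ≤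
      scaleNodeN (Δ + s * dΔ) (a + s * da) (b + s * db) (c + s * dc) (e + s * σp) / scaleNodeD (Δ + s * dΔ) (a + s * da) (b + s * db) (c + s * dc) (e + s * σp) := by
  obtain ⟨h1, h2, h3, h4, h5⟩ := hm
  obtain ⟨g1, g2, g3, g4, g5, -, -, g8⟩ := hcd
  exact scaleNode_ge_mul_of_rayLeaf h h1 h2 h3 g5 h5 g1 g2 g3 g4 g8 h4

end Leaves

/-! ## §2 The ray cell check and its two readings -/

/-- **`rayCellCheck`**: on the family box `F` (anchor coordinates `Δ, a, b`, the step cell `s`; the `e`-slot of `F` is the ANCHOR WINDOW `W`) and the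
member window `Wh` (hard nesting, UPPER only): bisection (depth `n`) of the easy leaf and of the ray leaf over `W` (and, UPPER, of the hard leaf over
`Wh`); the sign and regime tests at the anchor and at the member; positivity of the shifted energies. [folklore] -/
def rayCellCheck (upper : Bool) (cd : RayCellData) (n : ℕ) (F : SBox) (Wh : FI) : Bool :=
  let DM := F.iD.add (F.iS.mul cd.dD)
  let AM := F.iA.add (F.iS.mul cd.dA)
  let BM := F.iB.add (F.iS.mul cd.dB)
  let CM := cd.IC.add (F.iS.mul cd.dC)
  let etop : FI := if upper then thin Wh.hi else (thin F.iE.hi).add (F.iS.mul cd.sgE)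
  SBox.deep (rayEasyLeaf cd) n F && (if upper then SBox.deep (rayHardLeaf cd) n { F with iE := Wh } else true) &&
  SBox.deep (rayPathLeaf upper cd) n F &&
  decide (0 < F.iD.lo) && decide (0 < F.iA.lo) && decide (0 ≤ F.iB.lo) && decide (0 ≤ cd.IC.lo) && decide (0 < DM.lo) && decide (0 < AM.lo) &&
  decide (0 ≤ BM.lo) && decide (0 ≤ CM.lo) && decide (0 ≤ (BM.sub CM).lo) && decide (0 ≤ F.iS.lo) &&
  decide ((CM.mul etop).hi < (AM.sqr).lo) && decide ((BM.mul DM).hi < ((AM.sqr).mulInt 4).lo) &&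
  decide (0 < ((thin F.iE.lo).add (F.iS.mul cd.sgP)).lo) && decide (0 < ((thin F.iE.lo).add (F.iS.mul cd.sgE)).lo) && decide (0 < F.iE.lo) &&
  (if upper then decide (0 < ((thin Wh.lo).add (F.iS.mul cd.sgH)).lo) && decide (((thin F.iE.hi).add (F.iS.mul cd.sgE)).hi ≤ Wh.hi) else true)

section Cell

variable {cd : RayCellData} {dΔ da db dc c : ℝ} {n : ℕ} {F : SBox} {Wh : FI}

/-- The scalar part of `rayCellCheck`, read in `ℝ`. [folklore] -/
theorem rayCellCheck_scalars {upper : Bool} {σe σh σp : ℝ} (hcd : (FI.mem dΔ cd.dD ∧ FI.mem da cd.dA ∧ FI.mem db cd.dB ∧ FI.mem dc cd.dC ∧ FI.mem c cd.IC ∧ FI.mem σe cd.sgE ∧ FI.mem σh cd.sgH ∧ FI.mem σp cd.sgP))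
    (h : rayCellCheck upper cd n F Wh = true) {Δ a b s : ℝ} (hD : FI.mem Δ F.iD) (hA : FI.mem a F.iA) (hB : FI.mem b F.iB) (hS : FI.mem s F.iS) :
    SBox.deep (rayEasyLeaf cd) n F = true ∧ (upper = true → SBox.deep (rayHardLeaf cd) n { F with iE := Wh } = true) ∧
    SBox.deep (rayPathLeaf upper cd) n F = true ∧
    0 < Δ ∧ 0 < a ∧ 0 ≤ b ∧ 0 ≤ c ∧ 0 < Δ + s * dΔ ∧ 0 < a + s * da ∧ 0 ≤ b + s * db ∧ 0 ≤ c + s * dc ∧ c + s * dc ≤ b + s * db ∧ 0 ≤ s ∧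
    (c + s * dc) * (if upper then ((Wh.hi : ℝ) / SC) else ((F.iE.hi : ℝ) / SC + s * σe)) < (a + s * da) ^ 2 ∧
    (b + s * db) * (Δ + s * dΔ) < 4 * (a + s * da) ^ 2 ∧
    0 < (F.iE.lo : ℝ) / SC + s * σp ∧ 0 < (F.iE.lo : ℝ) / SC + s * σe ∧ 0 < (F.iE.lo : ℝ) / SC ∧
    (upper = true → 0 < (Wh.lo : ℝ) / SC + s * σh ∧ (F.iE.hi : ℝ) / SC + s * σe ≤ (Wh.hi : ℝ) / SC) := by
  obtain ⟨g1, g2, g3, g4, g5, g6, g7, g8⟩ := hcd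
  unfold rayCellCheck at h
  simp only [Bool.and_eq_true, decide_eq_true_eq] at h
  obtain ⟨⟨⟨⟨⟨⟨⟨⟨⟨⟨⟨⟨⟨⟨⟨⟨⟨⟨heasy, hhard⟩, hpath⟩, hD0⟩, hA0⟩, hB0⟩, hC0⟩, hDM⟩, hAM⟩, hBM⟩, hCM⟩, hBMc⟩, hs0⟩, hregm⟩, hregq⟩, hpos1⟩, hpos2⟩,
    hlo0⟩, hup⟩ := h
  have mDM := FI.mem_add hD (FI.mem_mul hS g1)
  have mAM := FI.mem_add hA (FI.mem_mul hS g2)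
  have mBM := FI.mem_add hB (FI.mem_mul hS g3)
  have mCM := FI.mem_add g5 (FI.mem_mul hS g4)
  have mlo : FI.mem ((F.iE.lo : ℝ) / SC) (thin F.iE.lo) := mem_thin _
  refine ⟨heasy, ?_, hpath, FI.pos_of_lo_pos hD hD0, FI.pos_of_lo_pos hA hA0, nonneg_of_lo_nonneg hB hB0, nonneg_of_lo_nonneg g5 hC0,
    FI.pos_of_lo_pos mDM hDM, FI.pos_of_lo_pos mAM hAM, nonneg_of_lo_nonneg mBM hBM, nonneg_of_lo_nonneg mCM hCM, ?_, nonneg_of_lo_nonneg hS hs0,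
    ?_, ?_, ?_, ?_, div_pos (by exact_mod_cast hlo0) SC_pos, ?_⟩
  · intro hu; subst hu; simpa using hhard
  · have := nonneg_of_lo_nonneg (FI.mem_sub mBM mCM) hBMc; linarith
  · have metop : FI.mem (if upper then ((Wh.hi : ℝ) / SC) else ((F.iE.hi : ℝ) / SC + s * σe))
        (if upper then thin Wh.hi else (thin F.iE.hi).add (F.iS.mul cd.sgE)) := by
      cases upper
      · simpa using FI.mem_add (mem_thin F.iE.hi) (FI.mem_mul hS g6)
      · simpa using mem_thin Wh.hi
    exact FI.lt_of_hi_lt_lo (FI.mem_mul mCM metop) (FI.mem_sqr mAM) hregm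
  · have := FI.lt_of_hi_lt_lo (FI.mem_mul mBM mDM) (FI.mem_mulInt (FI.mem_sqr mAM) 4) hregq
    push_cast at this; linarith
  · exact FI.pos_of_lo_pos (FI.mem_add mlo (FI.mem_mul hS g8)) hpos1
  · exact FI.pos_of_lo_pos (FI.mem_add mlo (FI.mem_mul hS g6)) hpos2
  · intro hu; subst hu
    simp only [↓reduceIte, Bool.and_eq_true, decide_eq_true_eq] at hup
    obtain ⟨hpos3, hwin1⟩ := hup
    have mlo' : FI.mem ((Wh.lo : ℝ) / SC) (thin Wh.lo) := mem_thin _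
    have mhi : FI.mem ((F.iE.hi : ℝ) / SC) (thin F.iE.hi) := mem_thin _
    exact ⟨FI.pos_of_lo_pos (FI.mem_add mlo' (FI.mem_mul hS g7)) hpos3, le_scaled_of_hi_le (FI.mem_add mhi (FI.mem_mul hS g6)) hwin1⟩

/-- **THE UPPER RAY CELL.** `rayCellCheck true` with rates `σe = −m`, `σh = ℓ`, `σp = −ℓ` (any signs): for every anchor `A = (Δ, a, b, c)` in the family
box and every step `s` in the cell, IF `ε_F(A) ∈ W` and `Wh.lo ≤ ε_F(M)` (member `M = A + s·d`), THEN **`T(M) ≤ (1 + s)·T(A)`**, together with the energy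
enclosure `ε_F(A) − ℓs ≤ ε_F(M) ≤ ε_F(A) − ms`. [folklore] -/
theorem ray_upper_cell {m ℓ ν : ℝ} (hcd : (FI.mem dΔ cd.dD ∧ FI.mem da cd.dA ∧ FI.mem db cd.dB ∧ FI.mem dc cd.dC ∧ FI.mem c cd.IC ∧ FI.mem (-m) cd.sgE ∧ FI.mem ℓ cd.sgH ∧ FI.mem (-ℓ) cd.sgP)) (hν0 : 0 < ν) (hν1 : ν < 1) (h : rayCellCheck true cd n F Wh = true)
    {Δ a b s : ℝ} (hD : FI.mem Δ F.iD) (hA : FI.mem a F.iA) (hB : FI.mem b F.iB) (hS : FI.mem s F.iS)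
    (hW : FI.mem (fermiEnergyOf Δ a b c ν) F.iE) (hcrude : (Wh.lo : ℝ) / SC ≤ fermiEnergyOf (Δ + s * dΔ) (a + s * da) (b + s * db) (c + s * dc) ν) :
    scaleNodeN (Δ + s * dΔ) (a + s * da) (b + s * db) (c + s * dc) (fermiEnergyOf (Δ + s * dΔ) (a + s * da) (b + s * db) (c + s * dc) ν) /
        scaleNodeD (Δ + s * dΔ) (a + s * da) (b + s * db) (c + s * dc) (fermiEnergyOf (Δ + s * dΔ) (a + s * da) (b + s * db) (c + s * dc) ν) ≤
      (1 + s) * (scaleNodeN Δ a b c (fermiEnergyOf Δ a b c ν) / scaleNodeD Δ a b c (fermiEnergyOf Δ a b c ν)) ∧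
    fermiEnergyOf Δ a b c ν - ℓ * s ≤ fermiEnergyOf (Δ + s * dΔ) (a + s * da) (b + s * db) (c + s * dc) ν ∧
    fermiEnergyOf (Δ + s * dΔ) (a + s * da) (b + s * db) (c + s * dc) ν ≤ fermiEnergyOf Δ a b c ν - m * s := by
  obtain ⟨heasy, hhard, hpath, HD, HA, HB, HC, HDM, HAM, HBM, HCM, HCMBM, Hs, Hregm, Hregq, Hpos1, Hpos2, Hlo, Hup⟩ :=
    rayCellCheck_scalars hcd h hD hA hB hS
  have hhard := hhard rfl
  obtain ⟨Hpos3, Hwin1⟩ := Hup rfl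
  simp only [↓reduceIte] at Hregm
  set EA := fermiEnergyOf Δ a b c ν with hEA
  set EM := fermiEnergyOf (Δ + s * dΔ) (a + s * da) (b + s * db) (c + s * dc) ν with hEM
  have hWI := mem_Icc_of_fimem hW
  -- (a) easy nesting at E := E_A: ε_F(M) ≤ E_A − m s, hence ε_F(M) ∈ Wh
  have heasyE := SBox.forall_of_deep (rayEasyLeaf_sound hcd) n F heasy Δ a b s EA ⟨hD, hA, hB, hS, hW⟩
  have hup : EM ≤ EA - m * s := by
    have hpos : 0 < EA + s * (-m) := by have := hWI.1; linarith
    have := fermiEnergyOf_le_of_transfer HD HA.ne' HC HB HDM.le HCM HBM hν0 hν1 hpos heasyE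
    linarith
  have hWhI : EM ∈ Icc ((Wh.lo : ℝ) / SC) ((Wh.hi : ℝ) / SC) := ⟨hcrude, by have := hWI.2; nlinarith⟩
  -- (b) hard nesting at E := E_M: E_A ≤ E_M + ℓ s
  have hhardE := SBox.forall_of_deep (rayHardLeaf_sound hcd) n { F with iE := Wh } hhard Δ a b s EM ⟨hD, hA, hB, hS, fimem_of_mem_Icc hWhI⟩
  have hlow : EA - ℓ * s ≤ EM := by
    have hpos : 0 < EM + s * ℓ := by have := hWhI.1; nlinarith
    have := fermiEnergyOf_le_of_transfer HDM HAM.ne' HCM HBM HD.le HC HB hν0 hν1 hpos hhardE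
    linarith
  refine ⟨?_, hlow, hup⟩
  -- (c) energy antitonicity at the member between E_A − ℓs and E_M, then the ray leaf at E := E_A
  have h1 : 0 < EA - ℓ * s := by have := hWI.1; nlinarith
  have hm : (c + s * dc) * EM < (a + s * da) ^ 2 := lt_of_le_of_lt (mul_le_mul_of_nonneg_left hWhI.2 HCM) Hregm
  have hanti := scaleNode_div_antitone HDM HCM HCMBM HAM.ne' h1 hlow hm Hregq
  have hray := SBox.forall_of_deep (rayPathLeaf_upper_sound hcd) n F hpath Δ a b s EA ⟨hD, hA, hB, hS, hW⟩
  have e1 : EA + s * -ℓ = EA - ℓ * s := by ring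
  rw [e1] at hray
  exact hanti.trans hray

/-- **THE LOWER RAY CELL.** `rayCellCheck false` with rates `σe = σp = u` (any sign): for every anchor `A` in the family box and every step `s` in the
cell, IF `ε_F(A) ∈ W` THEN **`(1 − s)·T(A) ≤ T(M)`** and `ε_F(M) ≤ ε_F(A) + us`. [folklore] -/
theorem ray_lower_cell {u σh ν : ℝ} (hcd : (FI.mem dΔ cd.dD ∧ FI.mem da cd.dA ∧ FI.mem db cd.dB ∧ FI.mem dc cd.dC ∧ FI.mem c cd.IC ∧ FI.mem u cd.sgE ∧ FI.mem σh cd.sgH ∧ FI.mem u cd.sgP)) (hν0 : 0 < ν) (hν1 : ν < 1) (h : rayCellCheck false cd n F Wh = true)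
    {Δ a b s : ℝ} (hD : FI.mem Δ F.iD) (hA : FI.mem a F.iA) (hB : FI.mem b F.iB) (hS : FI.mem s F.iS)
    (hW : FI.mem (fermiEnergyOf Δ a b c ν) F.iE) :
    (1 - s) * (scaleNodeN Δ a b c (fermiEnergyOf Δ a b c ν) / scaleNodeD Δ a b c (fermiEnergyOf Δ a b c ν)) ≤
      scaleNodeN (Δ + s * dΔ) (a + s * da) (b + s * db) (c + s * dc) (fermiEnergyOf (Δ + s * dΔ) (a + s * da) (b + s * db) (c + s * dc) ν) /
        scaleNodeD (Δ + s * dΔ) (a + s * da) (b + s * db) (c + s * dc) (fermiEnergyOf (Δ + s * dΔ) (a + s * da) (b + s * db) (c + s * dc) ν) ∧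
    fermiEnergyOf (Δ + s * dΔ) (a + s * da) (b + s * db) (c + s * dc) ν ≤ fermiEnergyOf Δ a b c ν + u * s := by
  obtain ⟨heasy, -, hpath, HD, HA, HB, HC, HDM, HAM, HBM, HCM, HCMBM, Hs, Hregm, Hregq, Hpos1, Hpos2, Hlo, -⟩ :=
    rayCellCheck_scalars hcd h hD hA hB hS
  simp only [Bool.false_eq_true, ↓reduceIte] at Hregm
  set EA := fermiEnergyOf Δ a b c ν with hEA
  set EM := fermiEnergyOf (Δ + s * dΔ) (a + s * da) (b + s * db) (c + s * dc) ν with hEM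
  have hWI := mem_Icc_of_fimem hW
  -- (a) easy nesting at E := E_A: ε_F(M) ≤ E_A + u s
  have heasyE := SBox.forall_of_deep (rayEasyLeaf_sound hcd) n F heasy Δ a b s EA ⟨hD, hA, hB, hS, hW⟩
  have hup : EM ≤ EA + u * s := by
    have hpos : 0 < EA + s * u := by have := hWI.1; linarith
    have := fermiEnergyOf_le_of_transfer HD HA.ne' HC HB HDM.le HCM HBM hν0 hν1 hpos heasyE
    linarith
  refine ⟨?_, hup⟩
  -- (b) the ray leaf at E := E_A, then energy antitonicity at the member between E_M and E_A + us
  have hEM0 : 0 < EM := fermiEnergyOf_pos HDM HAM.ne' HCM HBM hν0 hν1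
  have hm : (c + s * dc) * (EA + u * s) < (a + s * da) ^ 2 := by
    have : EA + u * s ≤ (F.iE.hi : ℝ) / SC + s * u := by have := hWI.2; linarith
    exact lt_of_le_of_lt (mul_le_mul_of_nonneg_left this HCM) Hregm
  have hanti := scaleNode_div_antitone HDM HCM HCMBM HAM.ne' hEM0 hup hm Hregq
  have hray := SBox.forall_of_deep (rayPathLeaf_lower_sound hcd) n F hpath Δ a b s EA ⟨hD, hA, hB, hS, hW⟩
  have e1 : EA + s * u = EA + u * s := by ring
  rw [e1] at hray
  exact hray.trans hanti

end Cell

/-! ## §3 The value cell -/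

/-- **`valueCheck upper IC U n F`**: bisection (depth `n`) of the value leaf over the family box `F` (coordinates `Δ, a, b`, dummy `s`, energy `e`)
with the `t_pp′` interval `IC`. [folklore] -/
def valueCheck (upper : Bool) (IC : FI) (U : ℤ) (n : ℕ) (F : SBox) : Bool :=
  SBox.deep (fun B => valueLeaf upper B.iD B.iA B.iB IC B.iE U) n F

section ValueCell

variable {IC : FI} {U : ℤ} {n : ℕ} {F : SBox} {c : ℝ}

/-- **SOUNDNESS OF `valueCheck true`**: `t((Δ, a, b, c); e) ≤ U/SC` on the box. [folklore] -/
theorem scaleNode_div_le_of_valueCheck (h : valueCheck true IC U n F = true) (hC : FI.mem c IC) {Δ a b s e : ℝ} (hD : FI.mem Δ F.iD)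
    (hA : FI.mem a F.iA) (hB : FI.mem b F.iB) (hS : FI.mem s F.iS) (hE : FI.mem e F.iE) :
    scaleNodeN Δ a b c e / scaleNodeD Δ a b c e ≤ (U : ℝ) / SC := by
  have hs : ∀ B : SBox, (fun B => valueLeaf true B.iD B.iA B.iB IC B.iE U) B = true → ∀ Δ a b s e : ℝ,
      (FI.mem Δ B.iD ∧ FI.mem a B.iA ∧ FI.mem b B.iB ∧ FI.mem s B.iS ∧ FI.mem e B.iE) → scaleNodeN Δ a b c e / scaleNodeD Δ a b c e ≤ (U : ℝ) / SC := by
    intro B hB' Δ a b s e hm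
    exact scaleNode_div_le_of_valueLeaf hB' hm.1 hm.2.1 hm.2.2.1 hC hm.2.2.2.2
  exact SBox.forall_of_deep (P := fun Δ a b _ e => scaleNodeN Δ a b c e / scaleNodeD Δ a b c e ≤ (U : ℝ) / SC) hs n F h Δ a b s e ⟨hD, hA, hB, hS, hE⟩

/-- **SOUNDNESS OF `valueCheck false`**: `U/SC ≤ t((Δ, a, b, c); e)` on the box. [folklore] -/
theorem le_scaleNode_div_of_valueCheck (h : valueCheck false IC U n F = true) (hC : FI.mem c IC) {Δ a b s e : ℝ} (hD : FI.mem Δ F.iD)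
    (hA : FI.mem a F.iA) (hB : FI.mem b F.iB) (hS : FI.mem s F.iS) (hE : FI.mem e F.iE) :
    (U : ℝ) / SC ≤ scaleNodeN Δ a b c e / scaleNodeD Δ a b c e := by
  have hs : ∀ B : SBox, (fun B => valueLeaf false B.iD B.iA B.iB IC B.iE U) B = true → ∀ Δ a b s e : ℝ,
      (FI.mem Δ B.iD ∧ FI.mem a B.iA ∧ FI.mem b B.iB ∧ FI.mem s B.iS ∧ FI.mem e B.iE) → (U : ℝ) / SC ≤ scaleNodeN Δ a b c e / scaleNodeD Δ a b c e := by
    intro B hB' Δ a b s e hm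
    exact le_scaleNode_div_of_valueLeaf hB' hm.1 hm.2.1 hm.2.2.1 hC hm.2.2.2.2
  exact SBox.forall_of_deep (P := fun Δ a b _ e => (U : ℝ) / SC ≤ scaleNodeN Δ a b c e / scaleNodeD Δ a b c e) hs n F h Δ a b s e ⟨hD, hA, hB, hS, hE⟩

end ValueCell

end Summit.Ventures.CertifiedManyBodySolver.Downfold.Emery
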